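import Summits.CriticalPhenomena.Ising3DConformalLimit.Theorems.EnergyNotSigmaSquaredMoebiusLimitExistsHrpFactorisation
import Summits.CriticalPhenomena.Ising3DConformalLimit.Theorems.EnergyNotSigmaSquaredMoebiusLimitExistsOneMapOneJetDefs
import Mathlib.Topology.Connected.PathConnected
import HarnessLib

/-!
# Line `one-map-one-jet` (crux `MoebiusLimitExists`, stmt-CriticalPhenomena-1344): dictionary and tightness of
the residual stub `stub_inversionGerm_even_ge_four`

The registered residual stub of the line (skeleton v3, `Cruxes/MoebiusLimitExists/Lines/one_map_one_jet.lean`)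
asks, for every normalised, non-degenerate, translation-invariant, scale-covariant pointwise scaling limit `S`
of the critical `ℤ³` correlators that is continuous off the diagonals and real-analytic on the good
configurations, at every EVEN order `n ≥ 4` and every doubly-good configuration `x`, for a point `x₀` joined
to `x` inside `InvGoodConfig n` at which the inversion defect `D_n = S n ∘ ι − (∏‖x i‖^{2Δ}) S n` has
vanishing germ. This file records, kernel-checked, where that stub sits:

* `inversionGerm_of_inversionCovariant` — inversion covariance of `S` gives the stub's conclusion at every
  order with `x₀ := x` (constant path): the per-path-component germ form is NOT stronger than clause (ii);
* `stub_inversionGerm_even_ge_four_of_items` — items stmt-CriticalPhenomena-1980 `LimitRotationInvariant`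
  and stmt-CriticalPhenomena-1982 `InversionUpgradeNormalised` of route HyperoctahedralRP (with
  `HRP2Rigidity` = item 1979, the tree theorem `HRP2Rigidity_of`) imply the stub verbatim;
* `stub_inversionGerm_even_ge_four_of_crux` (registered anchor) — the crux itself implies the stub
  verbatim (through `limitRotationInvariant_of_MoebiusLimitExists` /
  `inversionUpgradeNormalised_of_MoebiusLimitExists`, lead c4: any two non-degenerate limits of the critical
  correlators are proportional order by order, so covariance transfers from the Möbius witness). Hence the
  stub is TIGHT (crux-implied) and is not an independent conjecture: it is the inversion content of the
  3D-Ising conformal-covariance conjecture for the analytic 1981-type limit, at even orders `≥ 4`.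
-/

noncomputable section

open Set Function Filter EuclideanGeometry
open scoped Topology
open Literature.Probability.LatticeModels

namespace Summit.CriticalPhenomena.Ising3DConformalLimit.MoebiusLimitExistsOneMapOneJet

/-- Every configuration avoiding the pole has a neighbourhood of such configurations. [folklore] -/
theorem eventually_forall_ne_zero' {n : ℕ} {x : Fin n → EuclideanSpace ℝ (Fin 3)} (hx : ∀ i, x i ≠ 0) :
    ∀ᶠ y in 𝓝 x, ∀ i, y i ≠ 0 :=
  eventually_all.2 fun i => ((continuous_apply i).continuousAt (x := x)).eventually_ne (hx i)

/-- **Inversion covariance gives the germ form at every order**: an inversion-covariant family has vanishing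
inversion-defect germ at EVERY configuration avoiding the pole, so the residual stub's conclusion holds with
`x₀ := x` and the constant path. [cite: FrancescoMathieuSenechal1997, §4.3.1 eq. (4.62)] -/
theorem inversionGerm_of_inversionCovariant {Δ : ℝ} {S : CorrFamily 3}
    (hinv : IsInversionCovariant Δ S) (n : ℕ) :
    ∀ x ∈ InvGoodConfig n, ∃ x₀, JoinedIn (InvGoodConfig n) x x₀ ∧ inversionDefect Δ S n =ᶠ[𝓝 x₀] 0 := by
  intro x hx
  refine ⟨x, JoinedIn.refl hx, ?_⟩
  filter_upwards [eventually_forall_ne_zero' hx.1] with y hy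
  exact (isInversionCovariant_iff_inversionDefect Δ S).1 hinv n y hy

/-- **Dictionary: the residual stub ⟸ items 1980 ∧ 1982** (route HyperoctahedralRP; `HRP2Rigidity` = item
1979 is the tree theorem `HRP2Rigidity_of`): rotation invariance of the 1981-type limit by 1980, inversion
covariance by 1982, then `inversionGerm_of_inversionCovariant`. [folklore] -/
theorem stub_inversionGerm_even_ge_four_of_items
    (h1980 : Theses.HyperoctahedralRP.LimitRotationInvariant)
    (h1982 : Theses.HyperoctahedralRP.InversionUpgradeNormalised) :
    ∀ (ρ : ℝ → ℝ) (Δ : ℝ) (S : CorrFamily 3), (∀ δ ∈ Set.Ioc (0:ℝ) 1, 0 < ρ δ) → 0 < Δ →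
      HasPointwiseScalingLimit (criticalCorr 3) ρ S →
      (∀ n z, z ∉ NonCoincident 3 n → S n z = 0) → IsNondegenerateTwoPoint S →
      IsTranslationInvariant S → IsScaleCovariant Δ S →
      (∀ n, ContinuousOn (S n) (NonCoincident 3 n)) →
      (∀ n, AnalyticOnNhd ℝ (S n) (GoodConfig n)) →
      ∀ n, 4 ≤ n → Even n → ∀ x ∈ InvGoodConfig n, ∃ x₀, JoinedIn (InvGoodConfig n) x x₀ ∧
        inversionDefect Δ S n =ᶠ[𝓝 x₀] 0 := by
  intro ρ Δ S hρ _hΔ hlim hnorm hnd htr hsc _hcont _han n _h4 _he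
  have hrot : IsRotationInvariant S :=
    h1980 Summit.CriticalPhenomena.Ising3DConformalLimit.Cruxes.HRP2Rigidity.XRayMellin.HRP2Rigidity_of
      ρ Δ S hρ hlim hnorm hnd htr hsc
  have hinv : IsInversionCovariant Δ S := h1982 ρ Δ S hρ hlim hnorm hnd ⟨htr, hrot⟩ hsc
  exact inversionGerm_of_inversionCovariant hinv n

/-- **Tightness (registered anchor `stub_inversionGerm_even_ge_four_of_crux`): the crux implies the residual
stub verbatim** — the crux implies items 1980 and 1982
(`MoebiusLimitExistsOnlyInteraction.limitRotationInvariant_of_MoebiusLimitExists`,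
`…inversionUpgradeNormalised_of_MoebiusLimitExists`), then `stub_inversionGerm_even_ge_four_of_items`.
So `stub_inversionGerm_even_ge_four` is crux-implied (not over-strong). [folklore] -/
theorem stub_inversionGerm_even_ge_four_of_crux :
    Theses.PerfectScreening.MoebiusLimitExists →
    ∀ (ρ : ℝ → ℝ) (Δ : ℝ) (S : CorrFamily 3), (∀ δ ∈ Set.Ioc (0:ℝ) 1, 0 < ρ δ) → 0 < Δ →
      HasPointwiseScalingLimit (criticalCorr 3) ρ S →
      (∀ n z, z ∉ NonCoincident 3 n → S n z = 0) → IsNondegenerateTwoPoint S →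
      IsTranslationInvariant S → IsScaleCovariant Δ S →
      (∀ n, ContinuousOn (S n) (NonCoincident 3 n)) →
      (∀ n, AnalyticOnNhd ℝ (S n) (GoodConfig n)) →
      ∀ n, 4 ≤ n → Even n → ∀ x ∈ InvGoodConfig n, ∃ x₀, JoinedIn (InvGoodConfig n) x x₀ ∧
        inversionDefect Δ S n =ᶠ[𝓝 x₀] 0 :=
  fun h => stub_inversionGerm_even_ge_four_of_items
    (Summit.CriticalPhenomena.Ising3DConformalLimit.MoebiusLimitExistsOnlyInteraction.limitRotationInvariant_of_MoebiusLimitExists h)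
    (Summit.CriticalPhenomena.Ising3DConformalLimit.MoebiusLimitExistsOnlyInteraction.inversionUpgradeNormalised_of_MoebiusLimitExists h)

end Summit.CriticalPhenomena.Ising3DConformalLimit.MoebiusLimitExistsOneMapOneJet

end
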